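import Mathlib
import HarnessLib.Audit
import Summits.PneNP.PneNP.Theorems.PstarChordReadSlackCount

/-!
# `t + 2` slice-generic chords kill a terminal core of boundary slack `t` (ROUND-24, O1 at general slack; memo g22 §24)

FRONTIER range-avoidance ladder, rung F-N3, ROUND 24 (cell `pnp-ideate`, prover-2 memo `g22/O1-PAIRCORE-g22.md` §24; typed target
`PstarCoreBoundTargets.TerminalPeelable` (p646951); restricted-model proof complexity — nothing here bears on `P` versus `NP`).

**Theorem (`false_of_generic_chords`).**  On a pure typed `(r,3/2)`-expanding instance with simple overlaps, a terminal core `(J₀, w₁, w₂)` with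
`2·#bdry J₀ ≤ 3·#J₀ + t` has no `t + 2` distinct slice-generic chords.  This subsumes `PstarChordReadTwoChords` (`t = 0`, with the tight
hypotheses), `PstarChordReadSlackOne.false_of_slackOne_three_generic` (`t = 1`) and `PstarChordReadSlackTwoFour.false_of_slackTwo_four_generic`
(`t = 2`).

Proof.  Call a generic chord CLEAN if it is outside-gated, DIRTY otherwise (it then has an inside partner `{v, w}`, `w` read inside `J₀`).  Take a
matching `M` of maximum size in the SHARING GRAPH on the clean chords (edge = common partner).  The `2·#M` gates of the matched edges and the
`#Dirty` inside partners form a defect family with pairwise distinct boundary privates whose second variables are read elsewhere (the hub partner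
by the other gate, `w` inside), so `PstarChordReadSlackCount.card_le_slack'` gives `2·#M + #Dirty ≤ t`.  Hence at least two clean chords are
unmatched; by maximality they share no partner, and `PstarChordReadTwoChords.false_of_two_gated` ends it.  No Assumption A.
-/

set_option linter.dupNamespace false -- `Summit.PneNP.PneNP.…`: summit = sub-problem name (D-0017 single-conjunct layout)

open Finset Literature.Computability.Complexity
open Summit.PneNP.PneNP.Theorems.PstarTyped (Typed)
open Summit.PneNP.PneNP.Theorems.PstarSALevel (varSet bdry BoundaryExpanding SimpleOverlap)
open Summit.PneNP.PneNP.Theorems.PstarMaxSharingReaders (exists_mem_of_mem_bdry)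
open Summit.PneNP.PneNP.Theorems.PstarChordRepair (IsChord)
open Summit.PneNP.PneNP.Theorems.PstarCoreBoundTargets (Terminal)
open Summit.PneNP.PneNP.Theorems.PstarChordReadLemma (SliceGeneric)
open Summit.PneNP.PneNP.Theorems.PstarChordReadOutside (IsGate OutsideGated Partner)
open Summit.PneNP.PneNP.Theorems.PstarChordReadTwoChords (false_of_two_gated)
open Summit.PneNP.PneNP.Theorems.PstarChordReadTight (not_mem_and_card)
open Summit.PneNP.PneNP.Theorems.PstarChordReadSlackOne (exists_inside_partner mem_varSet_of_pair)
open Summit.PneNP.PneNP.Theorems.PstarChordReadSlackTwo (priv_mem priv_ne)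
open Summit.PneNP.PneNP.Theorems.PstarChordReadSlackCount (card_le_slack')

namespace Summit.PneNP.PneNP.Theorems.PstarChordReadSlackGeneral

variable {n m : ℕ} {I : LocalMap 4 n m} {r : ℕ} {y : Fin m → Bool} {J₀ : Finset (Fin m)} {w₁ w₂ : Finset (Fin n) × Finset (Fin m) × Bool}

/-- Two outside gates with the same partner on distinct privates are distinct outputs. -/
theorem gate_ne {a b g g' : Fin m} {v v' z : Fin n} (ha : a ∈ J₀) (hb : b ∈ J₀) (hvv : v ≠ v')
    (hG : IsGate I J₀ a g v z) (hG' : IsGate I J₀ b g' v' z) : g ≠ g' := by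
  intro e
  subst e
  have hvz : v ≠ z := hG.ne ha
  have hv'z : v' ≠ z := hG'.ne hb
  rcases hG.2.1 with ⟨h2, h3⟩ | ⟨h2, h3⟩ <;> rcases hG'.2.1 with ⟨h2', h3'⟩ | ⟨h2', h3'⟩
  · exact hvv (h2.symm.trans h2')
  · exact hvz (h2.symm.trans h2')
  · exact hv'z (h2'.symm.trans h2)
  · exact hvv (h3.symm.trans h3')

/-- A partner is never a boundary variable of the core (it is read by no output of `J₀`). -/
theorem partner_not_mem_bdry {c g : Fin m} {v z : Fin n} (hG : IsGate I J₀ c g v z) : z ∉ bdry I J₀ := fun hz => by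
  obtain ⟨j, hj, hzj⟩ := exists_mem_of_mem_bdry I hz
  exact hG.2.2 j hj hzj

/-- **`t + 2` SLICE-GENERIC CHORDS KILL A TERMINAL CORE OF BOUNDARY SLACK `t`.** -/
theorem false_of_generic_chords (hI : I.IsPure xorAndPred) (hT : Typed I) (hS : SimpleOverlap I) (hB : BoundaryExpanding r I)
    (ht : Terminal I r y J₀ w₁ w₂) {t : ℕ} (hslack : 2 * (bdry I J₀).card ≤ 3 * J₀.card + t) {𝒞 : Finset (Fin m)} (h𝒞J : 𝒞 ⊆ J₀)
    (hch : ∀ c ∈ 𝒞, IsChord I J₀ c) (hgen : ∀ c ∈ 𝒞, SliceGeneric I y J₀ c (w₁.2.1 ∪ w₂.2.1)) (hcard : t + 2 ≤ 𝒞.card) : False := by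
  classical
  -- clean and dirty chords
  set Clean := 𝒞.filter (fun c => OutsideGated I J₀ (w₁.2.1 ∪ w₂.2.1) c) with hClean
  set Dirty := 𝒞.filter (fun c => ¬ OutsideGated I J₀ (w₁.2.1 ∪ w₂.2.1) c) with hDirty
  have hCD : Clean.card + Dirty.card = 𝒞.card := card_filter_add_card_filter_not _
  have hCl : ∀ c ∈ Clean, c ∈ 𝒞 ∧ OutsideGated I J₀ (w₁.2.1 ∪ w₂.2.1) c := fun c hc => mem_filter.1 hc
  have hDi : ∀ c ∈ Dirty, c ∈ 𝒞 ∧ ¬ OutsideGated I J₀ (w₁.2.1 ∪ w₂.2.1) c := fun c hc => mem_filter.1 hc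
  have hCDne : ∀ a ∈ Clean, ∀ c ∈ Dirty, a ≠ c := fun a ha c hc e => (hDi c hc).2 (e ▸ (hCl a ha).2)
  -- a maximum matching of the sharing graph on the clean chords
  set IsM : Finset (Fin m × Fin m) → Prop := fun M =>
    (∀ e ∈ M, e.1 ∈ Clean ∧ e.2 ∈ Clean ∧ e.1 ≠ e.2 ∧ ∃ z, Partner I J₀ (w₁.2.1 ∪ w₂.2.1) e.1 z ∧ Partner I J₀ (w₁.2.1 ∪ w₂.2.1) e.2 z) ∧
    (∀ e ∈ M, ∀ e' ∈ M, e ≠ e' → e.1 ≠ e'.1 ∧ e.1 ≠ e'.2 ∧ e.2 ≠ e'.1 ∧ e.2 ≠ e'.2) with hIsM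
  obtain ⟨M, hMS, hMmax⟩ := exists_max_image (((Clean ×ˢ Clean).powerset).filter IsM) card
    ⟨∅, mem_filter.2 ⟨empty_mem_powerset _, fun e he => absurd he (by simp), fun e he => absurd he (by simp)⟩⟩
  obtain ⟨-, hM₁, hM₂⟩ := mem_filter.1 hMS
  -- choices: partners and gates of the matched edges, inside partners of the dirty chords
  obtain ⟨c₀, hc₀⟩ : 𝒞.Nonempty := card_pos.1 (by omega)
  haveI : Nonempty (Fin n) := ⟨I.vars c₀ 0⟩
  haveI : Nonempty (Fin m) := ⟨c₀⟩
  have hz : ∀ e ∈ M, ∃ z, Partner I J₀ (w₁.2.1 ∪ w₂.2.1) e.1 z ∧ Partner I J₀ (w₁.2.1 ∪ w₂.2.1) e.2 z := fun e he => (hM₁ e he).2.2.2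
  choose! z hz₁ hz₂ using hz
  have hg₁ : ∀ e ∈ M, ∃ g, g ∈ w₁.2.1 ∪ w₂.2.1 ∧ ∃ v, IsGate I J₀ e.1 g v (z e) := fun e he => by
    obtain ⟨g, hg, v, h⟩ := hz₁ e he; exact ⟨g, hg, v, h⟩
  have hg₂ : ∀ e ∈ M, ∃ g, g ∈ w₁.2.1 ∪ w₂.2.1 ∧ ∃ v, IsGate I J₀ e.2 g v (z e) := fun e he => by
    obtain ⟨g, hg, v, h⟩ := hz₂ e he; exact ⟨g, hg, v, h⟩
  choose! g₁ hg₁G hv₁ using hg₁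
  choose! v₁ hG₁ using hv₁
  choose! g₂ hg₂G hv₂ using hg₂
  choose! v₂ hG₂ using hv₂
  have hd : ∀ c ∈ Dirty, ∃ h, h ∈ w₁.2.1 ∪ w₂.2.1 ∧ ∃ v w : Fin n, (v = I.vars c 2 ∨ v = I.vars c 3) ∧
      ((I.vars h 2 = v ∧ I.vars h 3 = w) ∨ (I.vars h 2 = w ∧ I.vars h 3 = v)) ∧ ∃ j ∈ J₀, w ∈ varSet I j := fun c hc => by
    obtain ⟨h, hh, v, w, hv, hp, hw⟩ := exists_inside_partner (hDi c hc).2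
    exact ⟨h, hh, v, w, hv, hp, hw⟩
  choose! hm hhmG hvw using hd
  choose! vd wd hvd hpd hwd using hvw
  -- the chords behind the keys, all in `J₀`
  have hJ : ∀ c ∈ 𝒞, c ∈ J₀ := fun c hc => h𝒞J hc
  have he₁ : ∀ e ∈ M, e.1 ∈ 𝒞 := fun e he => (hCl _ (hM₁ e he).1).1
  have he₂ : ∀ e ∈ M, e.2 ∈ 𝒞 := fun e he => (hCl _ (hM₁ e he).2.1).1
  -- the defect family
  set K : Finset ((Fin m × Fin m) ⊕ (Fin m × Fin m) ⊕ Fin m) := M.disjSum (M.disjSum Dirty) with hK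
  set mon : (Fin m × Fin m) ⊕ (Fin m × Fin m) ⊕ Fin m → Fin m := Sum.elim g₁ (Sum.elim g₂ hm) with hmon
  set priv : (Fin m × Fin m) ⊕ (Fin m × Fin m) ⊕ Fin m → Fin n := Sum.elim v₁ (Sum.elim v₂ vd) with hpriv
  set sec : (Fin m × Fin m) ⊕ (Fin m × Fin m) ⊕ Fin m → Fin n := Sum.elim z (Sum.elim z wd) with hsec
  set ch : (Fin m × Fin m) ⊕ (Fin m × Fin m) ⊕ Fin m → Fin m := Sum.elim Prod.fst (Sum.elim Prod.snd id) with hchd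
  have memK : ∀ k ∈ K, (∃ e ∈ M, k = Sum.inl e) ∨ (∃ e ∈ M, k = Sum.inr (Sum.inl e)) ∨ (∃ c ∈ Dirty, k = Sum.inr (Sum.inr c)) := by
    intro k hk
    rcases k with e | e | c
    · exact Or.inl ⟨e, Finset.inl_mem_disjSum.1 hk, rfl⟩
    · exact Or.inr (Or.inl ⟨e, Finset.inl_mem_disjSum.1 (Finset.inr_mem_disjSum.1 hk), rfl⟩)
    · exact Or.inr (Or.inr ⟨c, Finset.inr_mem_disjSum.1 (Finset.inr_mem_disjSum.1 hk), rfl⟩)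
  -- per-key facts: chord in `𝒞`, private of that chord, monomial in the menu with AND pair `{priv, sec}`
  have facts : ∀ k ∈ K, ch k ∈ 𝒞 ∧ (priv k = I.vars (ch k) 2 ∨ priv k = I.vars (ch k) 3) ∧ mon k ∈ w₁.2.1 ∪ w₂.2.1 ∧
      ((I.vars (mon k) 2 = priv k ∧ I.vars (mon k) 3 = sec k) ∨ (I.vars (mon k) 2 = sec k ∧ I.vars (mon k) 3 = priv k)) := by
    intro k hk
    rcases memK k hk with ⟨e, he, rfl⟩ | ⟨e, he, rfl⟩ | ⟨c, hc, rfl⟩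
    · exact ⟨he₁ e he, (hG₁ e he).1, hg₁G e he, (hG₁ e he).2.1⟩
    · exact ⟨he₂ e he, (hG₂ e he).1, hg₂G e he, (hG₂ e he).2.1⟩
    · exact ⟨(hDi c hc).1, hvd c hc, hhmG c hc, hpd c hc⟩
  -- distinct keys have distinct chords
  have ch_inj : ∀ k ∈ K, ∀ k' ∈ K, ch k = ch k' → k = k' := by
    intro k hk k' hk' e
    rcases memK k hk with ⟨a, ha, rfl⟩ | ⟨a, ha, rfl⟩ | ⟨c, hc, rfl⟩ <;>
      rcases memK k' hk' with ⟨b, hb, rfl⟩ | ⟨b, hb, rfl⟩ | ⟨d, hd', rfl⟩ <;>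
      simp only [hchd, Sum.elim_inl, Sum.elim_inr, id] at e
    · by_cases hab : a = b
      · rw [hab]
      · exact absurd e (hM₂ a ha b hb hab).1
    · by_cases hab : a = b
      · subst hab; exact absurd e (hM₁ a ha).2.2.1
      · exact absurd e (hM₂ a ha b hb hab).2.1
    · exact absurd e (hCDne _ (hM₁ a ha).1 d hd')
    · by_cases hab : a = b
      · subst hab; exact absurd e.symm (hM₁ a ha).2.2.1
      · exact absurd e (hM₂ a ha b hb hab).2.2.1
    · by_cases hab : a = b
      · rw [hab]
      · exact absurd e (hM₂ a ha b hb hab).2.2.2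
    · exact absurd e (hCDne _ (hM₁ a ha).2.1 d hd')
    · exact absurd e.symm (hCDne _ (hM₁ b hb).1 c hc)
    · exact absurd e.symm (hCDne _ (hM₁ b hb).2.1 c hc)
    · rw [e]
  -- the count: `#K ≤ t`
  have hKt : K.card ≤ t := by
    refine card_le_slack' I hB K mon priv sec (fun k hk => (not_mem_and_card ht (facts k hk).2.2.1).1) (fun k hk => (facts k hk).2.2.2)
      (fun k hk => ⟨ch k, hJ _ (facts k hk).1, (priv_mem (hch _ (facts k hk).1) (facts k hk).2.1).1⟩)
      (fun k hk => (priv_mem (hch _ (facts k hk).1) (facts k hk).2.1).2) (fun k hk => ?_) (fun k hk k' hk' e => ?_) ?_ hslack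
    · -- the second variable is read elsewhere
      rcases memK k hk with ⟨e, he, rfl⟩ | ⟨e, he, rfl⟩ | ⟨c, hc, rfl⟩
      · refine Or.inr ⟨Sum.inr (Sum.inl e), Finset.inr_mem_disjSum.2 (Finset.inl_mem_disjSum.2 he), ?_, ?_⟩
        · exact (gate_ne (hJ _ (he₁ e he)) (hJ _ (he₂ e he))
            (priv_ne (hJ _ (he₁ e he)) (hJ _ (he₂ e he)) (hM₁ e he).2.2.1 (hch _ (he₁ e he)) (hch _ (he₂ e he)) (hG₁ e he).1 (hG₂ e he).1)
            (hG₁ e he) (hG₂ e he)).symm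
        · exact (mem_varSet_of_pair (hG₂ e he).2.1).2
      · refine Or.inr ⟨Sum.inl e, Finset.inl_mem_disjSum.2 he, ?_, ?_⟩
        · exact gate_ne (hJ _ (he₁ e he)) (hJ _ (he₂ e he))
            (priv_ne (hJ _ (he₁ e he)) (hJ _ (he₂ e he)) (hM₁ e he).2.2.1 (hch _ (he₁ e he)) (hch _ (he₂ e he)) (hG₁ e he).1 (hG₂ e he).1)
            (hG₁ e he) (hG₂ e he)
        · exact (mem_varSet_of_pair (hG₁ e he).2.1).2
      · exact Or.inl (hwd c hc)
    · -- distinct privates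
      by_contra hne
      have hcc : ch k ≠ ch k' := fun h => hne (ch_inj k hk k' hk' h)
      exact priv_ne (hJ _ (facts k hk).1) (hJ _ (facts k' hk').1) hcc (hch _ (facts k hk).1) (hch _ (facts k' hk').1) (facts k hk).2.1
        (facts k' hk').2.1 e
    · -- inside `J₀ ∪ G₁ ∪ G₂`
      refine (card_le_card fun j hj => ?_).trans ht.2.2.2.2.2.1
      rcases mem_union.1 hj with hj | hj
      · exact mem_union_left _ (mem_union_left _ hj)
      · obtain ⟨k, hk, rfl⟩ := mem_image.1 hj
        rcases mem_union.1 (facts k hk).2.2.1 with h | h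
        exacts [mem_union_left _ (mem_union_right _ h), mem_union_right _ h]
  have hKcard : K.card = M.card + (M.card + Dirty.card) := by rw [hK, card_disjSum, card_disjSum]
  -- two unmatched clean chords
  set V := M.image Prod.fst ∪ M.image Prod.snd with hV
  have hVcard : V.card ≤ M.card + M.card := (card_union_le _ _).trans (add_le_add card_image_le card_image_le)
  have hU : 1 < (Clean \ V).card := by
    have := le_card_sdiff V Clean
    omega
  obtain ⟨a, ha, b, hb, hab⟩ := one_lt_card.1 hU
  obtain ⟨haC, haV⟩ := mem_sdiff.1 ha
  obtain ⟨hbC, hbV⟩ := mem_sdiff.1 hb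
  have notV : ∀ {u}, u ∉ V → ∀ e ∈ M, u ≠ e.1 ∧ u ≠ e.2 := fun hu e he =>
    ⟨fun h => hu (mem_union_left _ (mem_image.2 ⟨e, he, h.symm⟩)), fun h => hu (mem_union_right _ (mem_image.2 ⟨e, he, h.symm⟩))⟩
  -- by maximality they share no partner
  have hns : ∀ x, Partner I J₀ (w₁.2.1 ∪ w₂.2.1) a x → Partner I J₀ (w₁.2.1 ∪ w₂.2.1) b x → False := by
    intro x hxa hxb
    have habM : (a, b) ∉ M := fun h => (notV haV _ h).1 rfl
    have hM' : insert (a, b) M ∈ ((Clean ×ˢ Clean).powerset).filter IsM := by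
      refine mem_filter.2 ⟨?_, ?_, ?_⟩
      · rw [mem_powerset]
        refine insert_subset_iff.2 ⟨mem_product.2 ⟨haC, hbC⟩, ?_⟩
        have := (mem_filter.1 hMS).1
        rwa [mem_powerset] at this
      · intro e he
        rcases mem_insert.1 he with rfl | he
        · exact ⟨haC, hbC, hab, x, hxa, hxb⟩
        · exact hM₁ e he
      · intro e he e' he' hne
        rcases mem_insert.1 he with rfl | he <;> rcases mem_insert.1 he' with rfl | he'
        · exact absurd rfl hne
        · exact ⟨(notV haV e' he').1, (notV haV e' he').2, (notV hbV e' he').1, (notV hbV e' he').2⟩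
        · exact ⟨fun h => (notV haV e he).1 h.symm, fun h => (notV hbV e he).1 h.symm, fun h => (notV haV e he).2 h.symm,
            fun h => (notV hbV e he).2 h.symm⟩
        · exact hM₂ e he e' he' hne
    have := hMmax _ hM'
    rw [card_insert_of_notMem habM] at this
    omega
  exact false_of_two_gated hI hT hS hB ht (hJ a (hCl a haC).1) (hJ b (hCl b hbC).1) hab (hch a (hCl a haC).1) (hch b (hCl b hbC).1)
    (hCl a haC).2 (hCl b hbC).2 hns (hgen a (hCl a haC).1) (hgen b (hCl b hbC).1)

end Summit.PneNP.PneNP.Theorems.PstarChordReadSlackGeneral
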